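import Literature.IUT.HodgeTheaters.PMBaseStrips
import Literature.IUT.HodgeTheaters.PMBaseDischarge
import Literature.IUT.HodgeTheaters.PiAvatarBaseKitThetaNFInstances
import HarnessLib

/-!
# [IUTchI] Def 6.1 (iv) «precisely two `+`-full poly-isomorphisms» (F-2039) and Prop 6.5 (i) (F-2019) BY NAME
# at every kit's model strip / every `𝒟`-prime-strip, and at the Θ-NF kits OF RECORD `baseKitThetaNF`,
# `baseKitThetaNFOfBadPairs`, `baseKitThetaNFStandIn` (proof-only; abc-iut-f-193 gen 10, L5 ROWS #5 rows R2 + R3)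

S. Mochizuki, *Inter-universal Teichmüller theory I: construction of Hodge theaters*, kurims manuscript (May 2020),
Def 6.1 (iv) p. 157 «In particular, if `†𝔇 = ‡𝔇`, then there are precisely two `+`-full poly-isomorphisms
`†𝒟_v ⥲ ‡𝒟_v`» and Prop 6.5 (i) pp. 163–164 (the bijections `†ξ^{Θell}_{v_t,w_t}` are compatible with the
`𝔽_l^±`-group structures) ([IUTchI] Def 6.1 (iv) p.157) [claim: Mochizuki2012, status: disputed] (D-0012 claim key;
series status DISPUTED — kernel theorems about abc-iut-L5-t4's CONSTRUCTIONS over abc-iut-L5-t2's REAL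
`InitialThetaData`; nothing of the series is asserted, no side is taken on [IUTchIII] Cor. 3.12).

## Why this file (abc-iut cell, FACT-LIST rows F-2039 / F-2019, L5-lead g8 ROWS #5 R2 «F-2039-INSTANCE», R3 «F-2019-INSTANCE»)
* F-2039 `PMBaseKit.PreciselyTwoPlusFullPolyAut v X` (abc-iut-w4-d073, `PMBaseStrips.lean` p405878) had exactly ONE closer
  in the tree, `PMBaseKit.preciselyTwoPlusFullPolyAut (hX : K.IsLocal v X)`, and NO instance theorem.  Its hypothesis
  `K.IsLocal v X := Nonempty (X ≅ K.model v)` is STRUCTURAL: it holds at every kit's model object (`isLocal_model`) and at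
  every component of every `𝒟`-prime-strip (`DStrip.isLocal`).  §1 records the hypothesis-free firings
  `preciselyTwoPlusFullPolyAut_model` / `DStrip.preciselyTwoPlusFullPolyAut_obj` / `preciselyTwoPlusFullPolyAut_of_iso`
  (every kit, every `l`), §2 the named firings at the three Θ-NF kits of the initial Θ-data.
* F-2019 `PMBaseKit.DThetaEllBridge.XiGroupCompat` (abc-iut-L5-t4, `PMBaseBridgeProps.lean`) is fired BY NAME at ten genuine
  kits in `PiAvatarBaseKitProp65i.lean` (abc-iut-w5-d086) but NOT at the Θ-NF kits `baseKitThetaNF` /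
  `baseKitThetaNFOfBadPairs` / `baseKitThetaNFStandIn` (abc-iut-L5-t4 / w4-d054, `PiAvatarBaseKitThetaNFInstances.lean`;
  `baseKitThetaNFStandIn` = the D-JΘ1-2 repair path OF RECORD, L5-lead RULINGS #86 (9)).  §2 supplies them via the (α) route
  `xiGroupCompat_of_sync` (abc-iut-L5-t13 `PMBaseDischarge`, no parity condition) applied to the landed (α) laws
  `phiEllSync_baseKitThetaNF*`, together with the first sentence `inducesZeta_…` and the conjunction `prop65i_…`.

Binders are exactly those of the kit decorated (`B CG hS hsurj hA Λ` / `CG hS M hA hI B ΛBad` / `CG hS M hA hI`), displayed, FACT 0.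
HONEST LABEL for `baseKitThetaNFStandIn`: «[`X̲→`-profinite stand-in at `v̲ ∈ V̲^bad`]: print's `𝒟_v̲` there is `ℬ^temp(X̳_v̲)⁰`,
NOT this kit's `ℬ(Π_{X̲→_v̲})⁰`».  Proof-only: no `def`, no `instance`, no `notation`, no new `Prop` fact; every proof is a
one-line application of landed theorems BY NAME.  Typed ≠ inhabited ≠ proved; an instance at OUR kits is not print's
universal claim (whose typed ∀-closure is a schema); nothing here asserts that abc is proved or refuted.
-/

namespace Literature.IUT.HodgeTheaters

open CategoryTheory

universe u v w

/-! ## §1 Def 6.1 (iv) «precisely two» — hypothesis-free at every kit -/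

namespace PMBaseKit

variable {l : ℕ} (K : PMBaseKit.{u} l)

/-- **[IUTchI] Def 6.1 (iv) at the MODEL `𝒟_v` of any kit**: «if `†𝔇 = ‡𝔇`, then there are precisely two `+`-full
poly-isomorphisms `†𝒟_v ⥲ ‡𝒟_v`» — for every base kit `K` and every `v ∈ 𝕍`, at `X := 𝒟_v` (hypothesis `IsLocal`
discharged by `isLocal_model`). ([IUTchI] Def 6.1 (iv) p.157) [claim: Mochizuki2012, status: disputed] -/
theorem preciselyTwoPlusFullPolyAut_model (v : K.V) : K.PreciselyTwoPlusFullPolyAut v (K.model v) :=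
  K.preciselyTwoPlusFullPolyAut (K.isLocal_model v)

/-- **[IUTchI] Def 6.1 (iv) at any isomorph of the model**: an object `X` HANDED an isomorphism `X ≅ 𝒟_v` has precisely
two `+`-full poly-automorphisms. ([IUTchI] Def 6.1 (iv) p.157) [claim: Mochizuki2012, status: disputed] -/
theorem preciselyTwoPlusFullPolyAut_of_iso {v : K.V} {X : K.Amb v} (φ : X ≅ K.model v) :
    K.PreciselyTwoPlusFullPolyAut v X :=
  K.preciselyTwoPlusFullPolyAut ⟨φ⟩

/-- **[IUTchI] Def 6.1 (iv) at every component `†𝒟_v` of every `𝒟`-prime-strip `†𝔇`** (the case «`†𝔇 = ‡𝔇`» of print,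
verbatim): precisely two `+`-full poly-isomorphisms `†𝒟_v ⥲ †𝒟_v` (hypothesis `IsLocal` = the strip's own field
`DStrip.isLocal`). ([IUTchI] Def 6.1 (iv) p.157) [claim: Mochizuki2012, status: disputed] -/
theorem DStrip.preciselyTwoPlusFullPolyAut_obj {K : PMBaseKit.{u} l} (D : K.DStrip) (v : K.V) :
    K.PreciselyTwoPlusFullPolyAut v (D.obj v) :=
  K.preciselyTwoPlusFullPolyAut (D.isLocal v)

/-- **[IUTchI] Def 6.1 (iv), all places at once, for a `𝒟`-prime-strip.** ([IUTchI] Def 6.1 (iv) p.157)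
[claim: Mochizuki2012, status: disputed] -/
theorem DStrip.forall_preciselyTwoPlusFullPolyAut {K : PMBaseKit.{u} l} (D : K.DStrip) :
    ∀ v : K.V, K.PreciselyTwoPlusFullPolyAut v (D.obj v) :=
  fun v => D.preciselyTwoPlusFullPolyAut_obj v

end PMBaseKit

/-! ## §2 At the Θ-NF kits of the initial Θ-data -/

section ThetaNFKits

variable {F : Type u} {K : Type v} {Fbar : Type w} [Field F] [NumberField F] [Field K] [NumberField K]
  [Algebra F K] [Field Fbar] [Algebra F Fbar] [Algebra K Fbar]
  {E : WeierstrassCurve F} [E.IsElliptic] {l : ℕ} {Pb : BadPlacePredicates K}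
  (D : InitialThetaData F K Fbar E l Pb)

namespace InitialThetaData

/-! ### `baseKitThetaNF B CG hS hsurj hA Λ` (over `V̲`) -/

section OverPlaces

variable (B : ∀ v, v ∈ D.indexCopyBad → D.BadPairAt v) (CG : D.geom.pe.CuspGalois) (hS : D.CuspClassesNormaliserStable)
  [Fact l.Prime] [(D.PiXund.subgroupOf D.PiXK).Normal] (hsurj : Function.Surjective D.toFlStarGlobal)
  (hA : D.geom.pe.ArrowCoveringClaims) (Λ : ∀ v, D.LocalArrowLaw CG hS (D.localGroupAt B v))

/-- **[IUTchI] Def 6.1 (iv) at the Θ-NF kit `baseKitThetaNF`, model strip**: precisely two `+`-full poly-automorphisms of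
`𝒟_v̲` at every `v̲ ∈ V̲`. ([IUTchI] Def 6.1 (iv) p.157) [claim: Mochizuki2012, status: disputed] -/
theorem preciselyTwoPlusFullPolyAut_baseKitThetaNF (v : (D.baseKitThetaNF B CG hS hsurj hA Λ).V) :
    (D.baseKitThetaNF B CG hS hsurj hA Λ).PreciselyTwoPlusFullPolyAut v ((D.baseKitThetaNF B CG hS hsurj hA Λ).model v) :=
  (D.baseKitThetaNF B CG hS hsurj hA Λ).preciselyTwoPlusFullPolyAut_model v

/-- **[IUTchI] Def 6.1 (iv) at the Θ-NF kit `baseKitThetaNF`, every `𝒟`-prime-strip.** ([IUTchI] Def 6.1 (iv) p.157)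
[claim: Mochizuki2012, status: disputed] -/
theorem preciselyTwoPlusFullPolyAut_dStrip_baseKitThetaNF (S : (D.baseKitThetaNF B CG hS hsurj hA Λ).DStrip)
    (v : (D.baseKitThetaNF B CG hS hsurj hA Λ).V) :
    (D.baseKitThetaNF B CG hS hsurj hA Λ).PreciselyTwoPlusFullPolyAut v (S.obj v) :=
  S.preciselyTwoPlusFullPolyAut_obj v

/-- **[IUTchI] Prop 6.5 (i), first sentence, at `baseKitThetaNF`**: every `𝒟-Θ^{ell}`-bridge induces the bijections
`†ζ^{Θell}_{v_t}` (abc-iut-L5-t13's unconditional `inducesZeta`). ([IUTchI] Prop 6.5 (i) p.163) [claim: Mochizuki2012, status: disputed] -/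
theorem inducesZeta_baseKitThetaNF (Bθ : (D.baseKitThetaNF B CG hS hsurj hA Λ).DThetaEllBridge) : Bθ.InducesZeta :=
  PMBaseKit.DThetaEllBridge.inducesZeta Bθ

/-- **[IUTchI] Prop 6.5 (i), second sentence (F-2019 `XiGroupCompat`), at `baseKitThetaNF`** — from the (α) law
`phiEllSync_baseKitThetaNF` via `xiGroupCompat_of_sync`. ([IUTchI] Prop 6.5 (i) p.164) [claim: Mochizuki2012, status: disputed] -/
theorem xiGroupCompat_baseKitThetaNF (Bθ : (D.baseKitThetaNF B CG hS hsurj hA Λ).DThetaEllBridge) : Bθ.XiGroupCompat :=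
  PMBaseKit.DThetaEllBridge.xiGroupCompat_of_sync (D.phiEllSync_baseKitThetaNF B CG hS hsurj hA Λ) Bθ

/-- **[IUTchI] Prop 6.5 (i) (both sentences) at `baseKitThetaNF`.** ([IUTchI] Prop 6.5 (i) pp.163-164)
[claim: Mochizuki2012, status: disputed] -/
theorem prop65i_baseKitThetaNF :
    (∀ Bθ : (D.baseKitThetaNF B CG hS hsurj hA Λ).DThetaEllBridge, Bθ.InducesZeta) ∧
      ∀ Bθ : (D.baseKitThetaNF B CG hS hsurj hA Λ).DThetaEllBridge, Bθ.XiGroupCompat :=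
  ⟨D.inducesZeta_baseKitThetaNF B CG hS hsurj hA Λ, D.xiGroupCompat_baseKitThetaNF B CG hS hsurj hA Λ⟩

end OverPlaces

/-! ### `baseKitThetaNFOfBadPairs CG hS M hA hI B ΛBad` (genuine shape) and `baseKitThetaNFStandIn CG hS M hA hI` -/

variable (CG : D.geom.pe.CuspGalois) (hS : D.CuspClassesNormaliserStable) [Fact l.Prime]
  (M : D.TorsionMonodromy) (hA : D.geom.pe.ArrowCoveringClaims)
  (hI : ∀ k ∈ D.geom.pe.inertia D.geom.pe.ε1, M.tau (D.geom.embK k) = 0)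

section Genuine

variable (B : ∀ v, v ∈ D.indexCopyBad → D.BadPairAt v)
  (ΛBad : ∀ v (h : v ∈ D.indexCopyBad), D.LocalArrowLaw CG hS (B v h).H)

/-- **[IUTchI] Def 6.1 (iv) at the genuine-shape Θ-NF kit `baseKitThetaNFOfBadPairs`, model strip.**
([IUTchI] Def 6.1 (iv) p.157) [claim: Mochizuki2012, status: disputed] -/
theorem preciselyTwoPlusFullPolyAut_baseKitThetaNFOfBadPairs (v : (D.baseKitThetaNFOfBadPairs CG hS M hA hI B ΛBad).V) :
    (D.baseKitThetaNFOfBadPairs CG hS M hA hI B ΛBad).PreciselyTwoPlusFullPolyAut v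
      ((D.baseKitThetaNFOfBadPairs CG hS M hA hI B ΛBad).model v) :=
  (D.baseKitThetaNFOfBadPairs CG hS M hA hI B ΛBad).preciselyTwoPlusFullPolyAut_model v

/-- **[IUTchI] Def 6.1 (iv) at `baseKitThetaNFOfBadPairs`, every `𝒟`-prime-strip.** ([IUTchI] Def 6.1 (iv) p.157)
[claim: Mochizuki2012, status: disputed] -/
theorem preciselyTwoPlusFullPolyAut_dStrip_baseKitThetaNFOfBadPairs
    (S : (D.baseKitThetaNFOfBadPairs CG hS M hA hI B ΛBad).DStrip) (v : (D.baseKitThetaNFOfBadPairs CG hS M hA hI B ΛBad).V) :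
    (D.baseKitThetaNFOfBadPairs CG hS M hA hI B ΛBad).PreciselyTwoPlusFullPolyAut v (S.obj v) :=
  S.preciselyTwoPlusFullPolyAut_obj v

/-- **[IUTchI] Prop 6.5 (i), first sentence, at `baseKitThetaNFOfBadPairs`.** ([IUTchI] Prop 6.5 (i) p.163)
[claim: Mochizuki2012, status: disputed] -/
theorem inducesZeta_baseKitThetaNFOfBadPairs (Bθ : (D.baseKitThetaNFOfBadPairs CG hS M hA hI B ΛBad).DThetaEllBridge) :
    Bθ.InducesZeta :=
  PMBaseKit.DThetaEllBridge.inducesZeta Bθ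

/-- **[IUTchI] Prop 6.5 (i), second sentence (F-2019 `XiGroupCompat`), at `baseKitThetaNFOfBadPairs`** — from the (α) law
`phiEllSync_baseKitThetaNFOfBadPairs` via `xiGroupCompat_of_sync`. ([IUTchI] Prop 6.5 (i) p.164) [claim: Mochizuki2012, status: disputed] -/
theorem xiGroupCompat_baseKitThetaNFOfBadPairs (Bθ : (D.baseKitThetaNFOfBadPairs CG hS M hA hI B ΛBad).DThetaEllBridge) :
    Bθ.XiGroupCompat :=
  PMBaseKit.DThetaEllBridge.xiGroupCompat_of_sync (D.phiEllSync_baseKitThetaNFOfBadPairs CG hS M hA hI B ΛBad) Bθ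

/-- **[IUTchI] Prop 6.5 (i) (both sentences) at `baseKitThetaNFOfBadPairs`.** ([IUTchI] Prop 6.5 (i) pp.163-164)
[claim: Mochizuki2012, status: disputed] -/
theorem prop65i_baseKitThetaNFOfBadPairs :
    (∀ Bθ : (D.baseKitThetaNFOfBadPairs CG hS M hA hI B ΛBad).DThetaEllBridge, Bθ.InducesZeta) ∧
      ∀ Bθ : (D.baseKitThetaNFOfBadPairs CG hS M hA hI B ΛBad).DThetaEllBridge, Bθ.XiGroupCompat :=
  ⟨D.inducesZeta_baseKitThetaNFOfBadPairs CG hS M hA hI B ΛBad, D.xiGroupCompat_baseKitThetaNFOfBadPairs CG hS M hA hI B ΛBad⟩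

end Genuine

/-- **[IUTchI] Def 6.1 (iv) at the Θ-NF STAND-IN kit `baseKitThetaNFStandIn`, model strip** «[`X̲→`-profinite stand-in at
`v̲ ∈ V̲^bad`]: print's `𝒟_v̲` there is `ℬ^temp(X̳_v̲)⁰`, NOT this kit's `ℬ(Π_{X̲→_v̲})⁰`». ([IUTchI] Def 6.1 (iv) p.157)
[claim: Mochizuki2012, status: disputed] -/
theorem preciselyTwoPlusFullPolyAut_baseKitThetaNFStandIn (v : (D.baseKitThetaNFStandIn CG hS M hA hI).V) :
    (D.baseKitThetaNFStandIn CG hS M hA hI).PreciselyTwoPlusFullPolyAut v ((D.baseKitThetaNFStandIn CG hS M hA hI).model v) :=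
  (D.baseKitThetaNFStandIn CG hS M hA hI).preciselyTwoPlusFullPolyAut_model v

/-- **[IUTchI] Def 6.1 (iv) at `baseKitThetaNFStandIn`, every `𝒟`-prime-strip** (stand-in label as above).
([IUTchI] Def 6.1 (iv) p.157) [claim: Mochizuki2012, status: disputed] -/
theorem preciselyTwoPlusFullPolyAut_dStrip_baseKitThetaNFStandIn (S : (D.baseKitThetaNFStandIn CG hS M hA hI).DStrip)
    (v : (D.baseKitThetaNFStandIn CG hS M hA hI).V) :
    (D.baseKitThetaNFStandIn CG hS M hA hI).PreciselyTwoPlusFullPolyAut v (S.obj v) :=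
  S.preciselyTwoPlusFullPolyAut_obj v

/-- **[IUTchI] Prop 6.5 (i), first sentence, at `baseKitThetaNFStandIn`** (stand-in label as above).
([IUTchI] Prop 6.5 (i) p.163) [claim: Mochizuki2012, status: disputed] -/
theorem inducesZeta_baseKitThetaNFStandIn (Bθ : (D.baseKitThetaNFStandIn CG hS M hA hI).DThetaEllBridge) : Bθ.InducesZeta :=
  PMBaseKit.DThetaEllBridge.inducesZeta Bθ

/-- **[IUTchI] Prop 6.5 (i), second sentence (F-2019 `XiGroupCompat`), at `baseKitThetaNFStandIn`** — from the (α) law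
`phiEllSync_baseKitThetaNFStandIn` via `xiGroupCompat_of_sync` (stand-in label as above). ([IUTchI] Prop 6.5 (i) p.164)
[claim: Mochizuki2012, status: disputed] -/
theorem xiGroupCompat_baseKitThetaNFStandIn (Bθ : (D.baseKitThetaNFStandIn CG hS M hA hI).DThetaEllBridge) : Bθ.XiGroupCompat :=
  PMBaseKit.DThetaEllBridge.xiGroupCompat_of_sync (D.phiEllSync_baseKitThetaNFStandIn CG hS M hA hI) Bθ

/-- **[IUTchI] Prop 6.5 (i) (both sentences) at `baseKitThetaNFStandIn`** (stand-in label as above).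
([IUTchI] Prop 6.5 (i) pp.163-164) [claim: Mochizuki2012, status: disputed] -/
theorem prop65i_baseKitThetaNFStandIn :
    (∀ Bθ : (D.baseKitThetaNFStandIn CG hS M hA hI).DThetaEllBridge, Bθ.InducesZeta) ∧
      ∀ Bθ : (D.baseKitThetaNFStandIn CG hS M hA hI).DThetaEllBridge, Bθ.XiGroupCompat :=
  ⟨D.inducesZeta_baseKitThetaNFStandIn CG hS M hA hI, D.xiGroupCompat_baseKitThetaNFStandIn CG hS M hA hI⟩

end InitialThetaData

end ThetaNFKits

end Literature.IUT.HodgeTheaters
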